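import Summits.HodgeConjecture.HodgeConjecture.Theorems.F0P3cStCharTSShellVal    -- ★ p849069 (this seat) D1 «SHELL-VAL»: `valuation_charpoly_coeff_shell_three`, `charpoly_diagonal_fin_three_coeff`
import HarnessLib

/-!
# F0 · P3c · line LH6 «StCharTS» — road (D) «DEEP-FL», brick D3-i «SHELL-ROOTS»: the ultrametric root ∕ coefficient dictionary for a split cubic, and the
# valuation pattern of a SPLIT TORUS ELEMENT conjugate to a shell element (`{v(d₀), ·, v(d₂)}` are its extreme entry valuations)

Cell `pub/hodgecm-mathlib`, crux H413 = `stmt-HodgeConjecture-24833` (`--supports` lane, helper), route HCCMUnconditional; seat LH6-p04 (g2), road (D) «DEEP-FL»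
(owner; desk F0P3b-plan (g23) ruling 2026-09-02T04:10:49Z (3)), sub-plan D3-i (bus 04:5xZ).  THEOREMS ONLY (generic: a field `K` with a valuation
`v : Valuation K Γ₀`; Mathlib + ★ D1 only), sorry-free, no definition ∕ instance ∕ notation ∕ named fact.  HONEST LABEL: HC_CM is proved only modulo the 7
printed citations (2 remaining: hLiu418 = stmt-HodgeConjecture-24832, h413 = stmt-HodgeConjecture-24833) until rung 0 closes; count-neutral; nothing about
`U(3)` is asserted here.

THE MATHEMATICS (folklore; the step «the orbit of a split regular `t` meets the shell `K_n z aᵐ K_n` only if `t` has the eigenvalue valuations of `z aᵐ`» of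
[Rogawski1990, §12.7 L. 12.7.3 proof p. 195] ∕ [Casselman1995, §1.5]).  For a monic cubic `X³ − e₁X² + e₂X − e₃` over a valued field:
* §1 `valuation_le_of_cubic_root` — the ultrametric CAUCHY BOUND: a root `t` (`t³ = e₁t² − e₂t + e₃`) with `v(e₁) ≤ A`, `v(e₂) ≤ A²`, `v(e₃) ≤ A³` has `v(t) ≤ A`;
  `le_valuation_of_cubic_root` — the dual bound through the reciprocal cubic (`e₃ ≠ 0`): `v(e₂) ≤ B⁻¹·v(e₃)`-type hypotheses give `B ≤ v(t)`.
* §2 `valuation_extremes_of_split_cubic` — for a SPLIT cubic `∏ (X − tᵢ)` whose coefficients have the SHELL PATTERN `v(e₁) = a₂`, `v(e₂) = a₁a₂`, `v(e₃) = a₀a₁a₂`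
  (`0 < a₀ ≤ a₁ ≤ a₂`): every root has `a₀ ≤ v(tᵢ) ≤ a₂`, and both extremes are attained.
* §3 `valuation_extremes_of_charpoly_diagonal_eq_shell` — if `diag(t₀, t₁, t₂)` has the same characteristic polynomial as a shell element `k₁ · diag(d) · k₂`
  (`k₁, k₂ ≡ 1 (mod r)`, `r < 1`, `v(d₀) < v(d₁) < v(d₂)`, `v(d₀) ≠ 0`; e.g. they are conjugate), then `v(d₀) ≤ v(tᵢ) ≤ v(d₂)` for all `i`, with both extremes
  attained (★ D1 `valuation_charpoly_coeff_shell_three` feeds §2) — so on the unitary torus (`v(t₁) = 1`, `v(t₀)v(t₂) = 1`, pattern `(q^{−m}, 1, q^{m})`) the element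
  `t` has the valuations of `b = z aᵐ` or of its Weyl conjugate `bʷ`: the TWO `N`-orbits of the deep shell, and the compact support of `t ↦ O_t(𝟙_{K_n b K_n})`
  inside `T^{reg}`.

## References
* [Rogawski1990] J. D. Rogawski, *Automorphic Representations of Unitary Groups in Three Variables*, Ann. of Math. Stud. 123 (1990): §12.7 L. 12.7.3 (proof) p. 195;
  §4.9 p. 55.
* [Casselman1995] W. Casselman, *Introduction to the theory of admissible representations of p-adic reductive groups* (1995 notes), Prop. 1.4.4, §1.5.
-/

set_option autoImplicit false
-- the mandated namespace has the single-problem summit's repeated segment (`HodgeConjecture.HodgeConjecture`)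
set_option linter.dupNamespace false

open Matrix Polynomial
open scoped BigOperators

namespace Summit.HodgeConjecture.HodgeConjecture.Cruxes.H413.F0P3cStCharTSShellRoots

variable {K : Type*} [Field K] {Γ₀ : Type*} [LinearOrderedCommGroupWithZero Γ₀] (v : Valuation K Γ₀)

/-! ## §1 The ultrametric Cauchy bound for a cubic and its dual -/

/-- **Ultrametric Cauchy bound (cubic)**: a root `t` of `X³ − e₁X² + e₂X − e₃` with `v(e₁) ≤ A`, `v(e₂) ≤ A²`, `v(e₃) ≤ A³` satisfies `v(t) ≤ A`.
[folklore] [cite: Casselman1995, §1.5] -/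
theorem valuation_le_of_cubic_root {t e₁ e₂ e₃ : K} {A : Γ₀} (ht : t ^ 3 = e₁ * t ^ 2 - e₂ * t + e₃)
    (h₁ : v e₁ ≤ A) (h₂ : v e₂ ≤ A ^ 2) (h₃ : v e₃ ≤ A ^ 3) : v t ≤ A := by
  by_contra hlt
  rw [not_le] at hlt
  have ht0 : v t ≠ 0 := ne_of_gt (lt_of_le_of_lt zero_le hlt)
  have hA : A < v t := hlt
  -- each term of the right side is strictly smaller than `v(t)³`
  have h1 : v (e₁ * t ^ 2) < v t ^ 3 := by
    rw [Valuation.map_mul, Valuation.map_pow, pow_succ (v t) 2, mul_comm (v t ^ 2)]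
    exact mul_lt_mul_of_pos_right (lt_of_le_of_lt h₁ hA) (pow_pos (zero_lt_iff.2 ht0) 2)
  have h2 : v (e₂ * t) < v t ^ 3 := by
    rw [Valuation.map_mul, pow_succ (v t) 2]
    refine mul_lt_mul_of_pos_right (lt_of_le_of_lt h₂ ?_) (zero_lt_iff.2 ht0)
    calc A ^ 2 = A * A := pow_two A
      _ ≤ A * v t := mul_le_mul' le_rfl hA.le
      _ < v t * v t := mul_lt_mul_of_pos_right hA (zero_lt_iff.2 ht0)
      _ = v t ^ 2 := (pow_two _).symm
  have h3 : v e₃ < v t ^ 3 := by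
    refine lt_of_le_of_lt h₃ ?_
    have hA2 : A ^ 2 ≤ v t ^ 2 := by
      rw [pow_two, pow_two]; exact mul_le_mul' hA.le hA.le
    calc A ^ 3 = A ^ 2 * A := pow_succ A 2
      _ ≤ v t ^ 2 * A := mul_le_mul' hA2 le_rfl
      _ < v t ^ 2 * v t := by
          rw [mul_comm (v t ^ 2) A, mul_comm (v t ^ 2) (v t)]
          exact mul_lt_mul_of_pos_right hA (pow_pos (zero_lt_iff.2 ht0) 2)
      _ = v t ^ 3 := (pow_succ _ 2).symm
  have hlt3 : v (e₁ * t ^ 2 - e₂ * t + e₃) < v t ^ 3 :=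
    lt_of_le_of_lt (Valuation.map_add v _ _) (max_lt (lt_of_le_of_lt (Valuation.map_sub v _ _) (max_lt h1 h2)) h3)
  rw [← ht, Valuation.map_pow] at hlt3
  exact lt_irrefl _ hlt3

/-- A root `t ≠ 0` of `X³ − e₁X² + e₂X − e₃` with `e₃ ≠ 0` gives the root `t⁻¹` of the reciprocal cubic `Y³ − (e₂e₃⁻¹)Y² + (e₁e₃⁻¹)Y − e₃⁻¹`. [folklore] -/
theorem inv_cubic_root {t e₁ e₂ e₃ : K} (ht : t ^ 3 = e₁ * t ^ 2 - e₂ * t + e₃) (ht0 : t ≠ 0) (he₃ : e₃ ≠ 0) :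
    t⁻¹ ^ 3 = (e₂ * e₃⁻¹) * t⁻¹ ^ 2 - (e₁ * e₃⁻¹) * t⁻¹ + e₃⁻¹ := by
  have he : t ^ 3 - e₁ * t ^ 2 + e₂ * t = e₃ := by linear_combination ht
  have hkey : t⁻¹ ^ 3 * (t ^ 3 - e₁ * t ^ 2 + e₂ * t) = 1 - e₁ * t⁻¹ + e₂ * t⁻¹ ^ 2 := by
    field_simp
  calc t⁻¹ ^ 3 = t⁻¹ ^ 3 * (e₃ * e₃⁻¹) := by rw [mul_inv_cancel₀ he₃, mul_one]
    _ = t⁻¹ ^ 3 * (t ^ 3 - e₁ * t ^ 2 + e₂ * t) * e₃⁻¹ := by rw [he, mul_assoc]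
    _ = (1 - e₁ * t⁻¹ + e₂ * t⁻¹ ^ 2) * e₃⁻¹ := by rw [hkey]
    _ = (e₂ * e₃⁻¹) * t⁻¹ ^ 2 - (e₁ * e₃⁻¹) * t⁻¹ + e₃⁻¹ := by ring

/-- **Dual bound**: a root `t ≠ 0` of `X³ − e₁X² + e₂X − e₃` (`e₃ ≠ 0`) with `B · v(e₂) ≤ v(e₃)`, `B² · v(e₁) ≤ v(e₃)`, `B³ ≤ v(e₃)` (`B ≠ 0`) satisfies
`B ≤ v(t)` (the Cauchy bound for the reciprocal cubic). [folklore] [cite: Casselman1995, §1.5] -/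
theorem le_valuation_of_cubic_root {t e₁ e₂ e₃ : K} {B : Γ₀} (ht : t ^ 3 = e₁ * t ^ 2 - e₂ * t + e₃) (ht0 : t ≠ 0) (he₃ : e₃ ≠ 0)
    (hB : B ≠ 0) (h₂ : B * v e₂ ≤ v e₃) (h₁ : B ^ 2 * v e₁ ≤ v e₃) (h₀ : B ^ 3 ≤ v e₃) : B ≤ v t := by
  have hv3 : v e₃ ≠ 0 := (Valuation.ne_zero_iff v).2 he₃
  have hv3i : v e₃ * (v e₃)⁻¹ = 1 := mul_inv_cancel₀ hv3
  -- the three coefficient bounds of the reciprocal cubic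
  have g₁ : v (e₂ * e₃⁻¹) ≤ B⁻¹ := by
    rw [Valuation.map_mul, Valuation.map_inv]
    calc v e₂ * (v e₃)⁻¹ = B⁻¹ * (B * v e₂) * (v e₃)⁻¹ := by rw [← mul_assoc, inv_mul_cancel₀ hB, one_mul]
      _ ≤ B⁻¹ * v e₃ * (v e₃)⁻¹ := mul_le_mul' (mul_le_mul' le_rfl h₂) le_rfl
      _ = B⁻¹ := by rw [mul_assoc, hv3i, mul_one]
  have g₂ : v (e₁ * e₃⁻¹) ≤ B⁻¹ ^ 2 := by
    rw [Valuation.map_mul, Valuation.map_inv, inv_pow]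
    calc v e₁ * (v e₃)⁻¹ = (B ^ 2)⁻¹ * (B ^ 2 * v e₁) * (v e₃)⁻¹ := by rw [← mul_assoc, inv_mul_cancel₀ (pow_ne_zero 2 hB), one_mul]
      _ ≤ (B ^ 2)⁻¹ * v e₃ * (v e₃)⁻¹ := mul_le_mul' (mul_le_mul' le_rfl h₁) le_rfl
      _ = (B ^ 2)⁻¹ := by rw [mul_assoc, hv3i, mul_one]
  have g₃ : v e₃⁻¹ ≤ B⁻¹ ^ 3 := by
    rw [Valuation.map_inv, inv_pow]
    calc (v e₃)⁻¹ = (B ^ 3)⁻¹ * B ^ 3 * (v e₃)⁻¹ := by rw [inv_mul_cancel₀ (pow_ne_zero 3 hB), one_mul]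
      _ ≤ (B ^ 3)⁻¹ * v e₃ * (v e₃)⁻¹ := mul_le_mul' (mul_le_mul' le_rfl h₀) le_rfl
      _ = (B ^ 3)⁻¹ := by rw [mul_assoc, hv3i, mul_one]
  have hinv := valuation_le_of_cubic_root v (inv_cubic_root ht ht0 he₃) g₁ g₂ g₃
  rw [Valuation.map_inv] at hinv
  have ht' : v t ≠ 0 := (Valuation.ne_zero_iff v).2 ht0
  rwa [inv_le_inv₀ (zero_lt_iff.2 ht') (zero_lt_iff.2 hB)] at hinv

/-! ## §2 Split cubics with the shell pattern: the extreme root valuations -/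

/-- **The extreme root valuations of a split cubic with the SHELL PATTERN.**  For `t₀ t₁ t₂` in a valued field and `e₁ = Σ tᵢ`, `e₂ = Σ_{i<j} tᵢtⱼ`, `e₃ = ∏ tᵢ`
with `v(e₁) = a₂`, `v(e₂) = a₁a₂`, `v(e₃) = a₀a₁a₂`, `0 < a₀ ≤ a₁ ≤ a₂`: every root has `a₀ ≤ v(tᵢ) ≤ a₂`, some root has `v = a₂` and some root has `v = a₀`.
[folklore] [cite: Casselman1995, §1.5] [cite: Rogawski1990, §12.7 L. 12.7.3 (proof) p. 195] -/
theorem valuation_extremes_of_split_cubic (t : Fin 3 → K) {a₀ a₁ a₂ : Γ₀} (ha₀ : a₀ ≠ 0) (h01 : a₀ ≤ a₁) (h12 : a₁ ≤ a₂)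
    (he₁ : v (t 0 + t 1 + t 2) = a₂) (he₂ : v (t 0 * t 1 + t 0 * t 2 + t 1 * t 2) = a₁ * a₂) (he₃ : v (t 0 * t 1 * t 2) = a₀ * a₁ * a₂) :
    (∀ i, v (t i) ≤ a₂) ∧ (∀ i, a₀ ≤ v (t i)) ∧ (∃ i, v (t i) = a₂) ∧ (∃ i, v (t i) = a₀) := by
  have ha₁ : a₁ ≠ 0 := ne_of_gt (lt_of_lt_of_le (zero_lt_iff.2 ha₀) h01)
  have ha₂ : a₂ ≠ 0 := ne_of_gt (lt_of_lt_of_le (lt_of_lt_of_le (zero_lt_iff.2 ha₀) h01) h12)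
  set e₁ := t 0 + t 1 + t 2 with he1
  set e₂ := t 0 * t 1 + t 0 * t 2 + t 1 * t 2 with he2
  set e₃ := t 0 * t 1 * t 2 with he3
  have he₃0 : e₃ ≠ 0 := fun h => by
    rw [h, Valuation.map_zero] at he₃
    exact mul_ne_zero (mul_ne_zero ha₀ ha₁) ha₂ he₃.symm
  -- every `tᵢ` is a root
  have hr0 : t 0 ^ 3 = e₁ * t 0 ^ 2 - e₂ * t 0 + e₃ := by simp only [he1, he2, he3]; ring
  have hr1 : t 1 ^ 3 = e₁ * t 1 ^ 2 - e₂ * t 1 + e₃ := by simp only [he1, he2, he3]; ring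
  have hr2 : t 2 ^ 3 = e₁ * t 2 ^ 2 - e₂ * t 2 + e₃ := by simp only [he1, he2, he3]; ring
  have hroot : ∀ i, t i ^ 3 = e₁ * t i ^ 2 - e₂ * t i + e₃ := by
    intro i; fin_cases i
    exacts [hr0, hr1, hr2]
  have hprod : t 0 * t 1 * t 2 ≠ 0 := by rw [← he3]; exact he₃0
  have hz0 : t 0 ≠ 0 := fun h => hprod (by rw [h, zero_mul, zero_mul])
  have hz1 : t 1 ≠ 0 := fun h => hprod (by rw [h, mul_zero, zero_mul])
  have hz2 : t 2 ≠ 0 := fun h => hprod (by rw [h, mul_zero])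
  have ht0 : ∀ i, t i ≠ 0 := by
    intro i; fin_cases i
    exacts [hz0, hz1, hz2]
  -- upper bound
  have hup : ∀ i, v (t i) ≤ a₂ := fun i =>
    valuation_le_of_cubic_root v (hroot i) he₁.le
      (by rw [he₂, pow_two]; exact mul_le_mul' h12 le_rfl)
      (by rw [he₃, pow_succ, pow_two]; exact mul_le_mul' (mul_le_mul' (h01.trans h12) h12) le_rfl)
  -- lower bound
  have hlow : ∀ i, a₀ ≤ v (t i) := fun i =>
    le_valuation_of_cubic_root v (hroot i) (ht0 i) he₃0 ha₀
      (by rw [he₂, he₃, mul_assoc])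
      (by rw [he₁, he₃, pow_two]; exact mul_le_mul' (mul_le_mul' le_rfl h01) le_rfl)
      (by rw [he₃, pow_succ, pow_two]; exact mul_le_mul' (mul_le_mul' le_rfl h01) (h01.trans h12))
  refine ⟨hup, hlow, ?_, ?_⟩
  · -- some root attains `a₂`: otherwise `v(e₁) < a₂`
    by_contra hne
    push Not at hne
    have hlt : ∀ i, v (t i) < a₂ := fun i => lt_of_le_of_ne (hup i) (hne i)
    have : v e₁ < a₂ :=
      lt_of_le_of_lt (Valuation.map_add v _ _)
        (max_lt (lt_of_le_of_lt (Valuation.map_add v _ _) (max_lt (hlt 0) (hlt 1))) (hlt 2))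
    exact absurd he₁ (ne_of_lt this)
  · -- some root attains `a₀`: otherwise `v(e₂) > a₁ a₂`… via `e₂ = e₃ · Σ tᵢ⁻¹`
    by_contra hne
    push Not at hne
    have hgt : ∀ i, a₀ < v (t i) := fun i => lt_of_le_of_ne (hlow i) (fun h => hne i h.symm)
    -- `v(tᵢ⁻¹) < a₀⁻¹`, hence `v(Σ tᵢ⁻¹) < a₀⁻¹` and `v(e₂) = v(e₃)·v(Σ tᵢ⁻¹) < a₁ a₂`
    have hsum : e₂ = e₃ * ((t 0)⁻¹ + (t 1)⁻¹ + (t 2)⁻¹) := by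
      rw [he2, he3]
      field_simp [ht0 0, ht0 1, ht0 2]
      ring
    have hinv : ∀ i, v ((t i)⁻¹) < a₀⁻¹ := fun i => by
      rw [Valuation.map_inv]
      exact (inv_lt_inv₀ (zero_lt_iff.2 ((Valuation.ne_zero_iff v).2 (ht0 i))) (zero_lt_iff.2 ha₀)).2 (hgt i)
    have hlt : v ((t 0)⁻¹ + (t 1)⁻¹ + (t 2)⁻¹) < a₀⁻¹ :=
      lt_of_le_of_lt (Valuation.map_add v _ _)
        (max_lt (lt_of_le_of_lt (Valuation.map_add v _ _) (max_lt (hinv 0) (hinv 1))) (hinv 2))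
    have : v e₂ < a₁ * a₂ := by
      rw [hsum, Valuation.map_mul, he₃]
      calc a₀ * a₁ * a₂ * v ((t 0)⁻¹ + (t 1)⁻¹ + (t 2)⁻¹) < a₀ * a₁ * a₂ * a₀⁻¹ :=
            mul_lt_mul_of_pos_left hlt (zero_lt_iff.2 (mul_ne_zero (mul_ne_zero ha₀ ha₁) ha₂))
        _ = a₁ * a₂ := by
            rw [mul_comm, ← mul_assoc, ← mul_assoc, inv_mul_cancel₀ ha₀, one_mul]
    exact absurd he₂ (ne_of_lt this)

/-! ## §3 A split torus element conjugate to a shell element -/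

/-- **THE VALUATION PATTERN OF A SPLIT ELEMENT IN THE SHELL'S CLASS.**  If `diag(t₀, t₁, t₂)` and a shell element `k₁ · diag(d₀, d₁, d₂) · k₂` (`k₁, k₂ ≡ 1 (mod r)`,
`r < 1`, `v(d₀) < v(d₁) < v(d₂)`, `v(d₀) ≠ 0`) have the SAME characteristic polynomial — e.g. they are conjugate — then `v(d₀) ≤ v(tᵢ) ≤ v(d₂)` for every `i`,
and both `v(d₂)` and `v(d₀)` are attained among the `v(tᵢ)`.  On the unitary torus (`t₂ = (σ t₀)⁻¹`, `v(t₁) = 1`, shell `(q^{−m}, 1, q^{m})·|z|`) this leaves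
exactly the valuation patterns of `b = z aᵐ` and of `bʷ` — the two `N`-orbits of the deep shell.
[cite: Rogawski1990, §12.7 L. 12.7.3 (proof) p. 195] [cite: Casselman1995, §1.5] -/
theorem valuation_extremes_of_charpoly_diagonal_eq_shell (t d : Fin 3 → K) (k₁ k₂ : Matrix (Fin 3) (Fin 3) K) {r : Γ₀} (hr : r < 1)
    (hk₁ : ∀ i j, v (k₁ i j - (1 : Matrix (Fin 3) (Fin 3) K) i j) ≤ r) (hk₂ : ∀ i j, v (k₂ i j - (1 : Matrix (Fin 3) (Fin 3) K) i j) ≤ r)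
    (h0 : v (d 0) ≠ 0) (h01 : v (d 0) < v (d 1)) (h12 : v (d 1) < v (d 2))
    (hchar : (Matrix.diagonal t).charpoly = (k₁ * Matrix.diagonal d * k₂).charpoly) :
    (∀ i, v (t i) ≤ v (d 2)) ∧ (∀ i, v (d 0) ≤ v (t i)) ∧ (∃ i, v (t i) = v (d 2)) ∧ (∃ i, v (t i) = v (d 0)) := by
  obtain ⟨hc2, hc1, hc0⟩ := F0P3cStCharTSShellVal.valuation_charpoly_coeff_shell_three v d k₁ k₂ hr hk₁ hk₂ h0 h01 h12
  obtain ⟨ht2, ht1, ht0⟩ := F0P3cStCharTSShellVal.charpoly_diagonal_fin_three_coeff t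
  rw [← hchar, ht2, Valuation.map_neg] at hc2
  rw [← hchar, ht1] at hc1
  rw [← hchar, ht0, Valuation.map_neg] at hc0
  exact valuation_extremes_of_split_cubic v t h0 h01.le h12.le hc2 hc1 hc0

end Summit.HodgeConjecture.HodgeConjecture.Cruxes.H413.F0P3cStCharTSShellRoots
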